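import Summits.BirchSwinnertonDyer.BirchSwinnertonDyer.Theorems.KolyvaginRankRigidityAtTwoOffHabitatIrredSwapHybridFrame
import Summits.BirchSwinnertonDyer.BirchSwinnertonDyer.Theorems.KolyvaginRankRigidityAtTwoSwapOfNamedFacts
import Summits.BirchSwinnertonDyer.BirchSwinnertonDyer.Theorems.KolyvaginRankRigidityAtTwoOffHabitatIrredInflationDefectOfOpenImage
import Summits.BirchSwinnertonDyer.BirchSwinnertonDyer.Theorems.Rank1ResidualJetWeilDatum
import Summits.BirchSwinnertonDyer.BirchSwinnertonDyer.Theorems.Rank1ResidualJetRingClassFields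
import Summits.BirchSwinnertonDyer.BirchSwinnertonDyer.Theorems.Rank1ResidualJetCoreVertexBridge
import Summits.BirchSwinnertonDyer.BirchSwinnertonDyer.Theorems.PoitouTateSelmerStructureDualityConjHolds
import Literature.NumberTheory.EllipticCurves.HeegnerPointsKolyvaginExceptionalSelmerProofs
import Literature.NumberTheory.EllipticCurves.WeilPairingTateDual
import Literature.NumberTheory.Sieve.FriedlanderIwaniecPrimesSquarefreeProofs
import HarnessLib

/-!
# Route `KolyvaginRankRigidityAtTwo`, residual crux R_irr `OffHabitatIrredNonSurjTwoConverse`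
# (stmt-BirchSwinnertonDyer-27123, LINE 8∞ `kolyvagin_depth_split_inf_irr`): S1L OFF THE HABITAT — the LOSSY prime
# swap at `2` (text of the habitat S1L `primeSwapAtTwoLossy_of_namedFacts` with the binder `(∀ m, ρ_{E,2^m} onto)`
# replaced by `E(ℚ)[2] = 0`) FROM TWO NAMED PRINT FACTS: Gross 1991 Prop. 3.7 (2) and Serre's open image theorem
# (width seat krr2-p2 g10; helper, `--supports` 27123)

`primeSwapAtTwoLossy_offHabitat_of_namedFacts (h37) (hSerre)`: Kolyvagin's prime swap [1] Prop. 8 = McCallum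
Prop. 5.2 = W. Zhang L8.4 step at `p = 2`, lossy form (`∃ c₀ c₂` chosen before the frame), Finset currency, for every
curve of R_irr's frame (non-CM, good-ordinary-or-multiplicative at `2`, `E(ℚ)[2] = 0`; `K` with `d_K` odd,
`d_K ∉ {−3, −4}`, Heegner for `N_E`). It is the habitat `primeSwapAtTwoLossy_of_namedFacts` (p640628) VERBATIM on the
frame data of its §1 (`exists_weilDatum_liftAut_two_pow`, `exists_hybridTransverseFamily`, the tree theorem
`InputsPoitouTateSelmer.poitouTate_selmerStructure_duality_conj_holds`), calling the off-habitat hybrid-frame swap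
`primeSwapAtTwoLossy_core_hybrid_offHabitat` with
* S2 off habitat `chebotarevOneClassIndexAtTwo_offHabitat hSerre` (p655785, `c₁`), and
* the uniform inflation defect `inflationDefect_of_serre hSerre` (p648454, `k`),
both consequences of Serre's open image theorem (named fact `serre_adicImage_contains_congruenceSubgroup`,
Silverman AEC III.7.9 (a)). Constants: `c₀ = 2 (c₁ + 2k + |Δ_min| + 16)`, `c₂ = c₁ + 2k + 4`. No new mathematics.
HONEST FRAMING: CONDITIONAL on the two named print facts (conditional-result); a helper for the re-threading of
V2irr / U2irr (LINE 8∞); nothing here proves R_irr, its stubs, or the Birch–Swinnerton-Dyer conjecture.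
[cite: Kolyvagin1991MathAnn, §2 Thm. 2.2, p. 257] [cite: McCallumLMS1991, §5 Prop. 5.2] [cite: WZhang2014, Lemma 8.4]
[cite: GrossLMS1991, Prop. 3.7 (2)] [cite: SilvermanAEC2009, Thm. III.7.9 (a)] [cite: MilneADT2006, Ch. I, Thm. 4.10] -/

set_option autoImplicit false
set_option linter.dupNamespace false

noncomputable section

open scoped Classical Pointwise
open Function NumberField IsDedekindDomain WeierstrassCurve Field
open Literature.NumberTheory.EllipticCurves Literature.NumberTheory.GaloisRepresentations
open Literature.NumberTheory.EllipticCurves.Jetchev2008 Literature.NumberTheory.EllipticCurves.ModularForms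
open Literature.NumberTheory.GaloisCohomology
open Literature.NumberTheory.GaloisRepresentations.DiscreteGaloisModule (localTatePairingZMod
  tateDual transverseSubgroup SelmerStructure)
open Literature.NumberTheory.Automorphic
open Summit.BirchSwinnertonDyer.Rank1Residual
open Summit.BirchSwinnertonDyer.Rank1Residual.JET.SelmerVocabulary
open Summit.BirchSwinnertonDyer.Rank1Residual.JET.GlobalDuality
open Summit.BirchSwinnertonDyer.BirchSwinnertonDyer.Theses.KolyvaginRankRigidityAtTwo
open Literature.NumberTheory.EllipticCurves.GrossLMS1991 (prop37_2_frobeniusCongruence)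

namespace Summit.BirchSwinnertonDyer.BirchSwinnertonDyer.Theorems.KolyvaginLowerBoundAtTwo

/-! ## S1L off the habitat from Gross 3.7 (2) and Serre's open image -/

/-- **S1L OFF THE HABITAT (the LOSSY prime swap at `2` on R_irr's frame) from Gross 1991 Prop. 3.7 (2) and Serre's
open image theorem** — the text of the habitat `primeSwapAtTwoLossy_of_namedFacts` with `(∀ m, ρ_{E,2^m} onto)`
replaced by `E(ℚ)[2] = 0`; Kolyvagin's [1] Prop. 8 = McCallum Prop. 5.2 = W. Zhang L8.4 step at `p = 2`, with a
constant loss `c₂ = c₁ + 2k + 4` per swap under the relative-order condition `M + c₀ ≤ 2j`. CONDITIONAL on `h37` and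
`hSerre` (named print facts); nothing here proves R_irr or BSD. [cite: Kolyvagin1991MathAnn, §2 Thm. 2.2, p. 257]
[cite: McCallumLMS1991, §5 Prop. 5.2] [cite: WZhang2014, Lemma 8.4] [cite: SilvermanAEC2009, Thm. III.7.9 (a)] -/
theorem primeSwapAtTwoLossy_offHabitat_of_namedFacts (h37 : prop37_2_frobeniusCongruence)
    (hSerre : serre_adicImage_contains_congruenceSubgroup) :
    ∀ (W : WeierstrassCurve ℚ) [W.IsElliptic] [W.IsGloballyMinimal], ¬ W.HasCM →
      (Rank1Residual.GoodOrd W 2 ∨ Rank1Residual.Mult W 2) →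
      AddSubgroup.torsionBy W.toAffine.Point (2 : ℤ) = ⊥ →
      ∀ (K : Type) [Field K] [NumberField K], IsImaginaryQuadratic K → NumberField.discr K ≠ -3 →
      NumberField.discr K ≠ -4 → ¬ ((2 : ℤ) ∣ NumberField.discr K) → ∀ [NeZero (W.conductorNorm ℤ)],
      SatisfiesHeegnerHypothesis (W.conductorNorm ℤ) K →
      ∃ c₀ c₂ : ℕ, ∀ (Dt : ModularParametrizationData W (W.conductorNorm ℤ)) (β : ℤ) (ι : K →+* ℂ),
        ∀ (M I : ℕ) (T : Finset ℕ) (a : ℕ)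
          (dat : KolyvaginHeegnerData Dt β ι (∏ p ∈ T, p)) (j : ℕ) (X : Finset ℕ),
          1 ≤ M → M + 1 ≤ I →
          (∀ p ∈ T, Zhang2014.IsKolyvaginPrime (W.conductorNorm ℤ) W K 2 p ∧
            M + 1 ≤ Zhang2014.kolyvaginIndex W 2 p) →
          a ∈ T → M + c₀ ≤ 2 * j →
          (∀ X' : Finset ℕ, ∃ q : ℕ, q ∉ X' ∧ Zhang2014.IsKolyvaginPrime (W.conductorNorm ℤ) W K 2 q ∧
            I ≤ Zhang2014.kolyvaginIndex W 2 q ∧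
            ∃ v : HeightOneSpectrum (𝓞 K), ((q : ℕ) : 𝓞 K) ∈ v.asIdeal ∧
              ((2 ^ j : ℕ) : ℤ) • dat.kolyvaginClass Nat.prime_two M ∉
                (W.baseChange K).torsionLocalKer (v.adicCompletion K) ((2 ^ M : ℕ) : ℤ)) →
          ∃ ℓ : ℕ, ℓ ∉ X ∧ ℓ ∉ T ∧ Zhang2014.IsKolyvaginPrime (W.conductorNorm ℤ) W K 2 ℓ ∧
            I ≤ Zhang2014.kolyvaginIndex W 2 ℓ ∧
            (∃ v : HeightOneSpectrum (𝓞 K), ((ℓ : ℕ) : 𝓞 K) ∈ v.asIdeal ∧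
              ((2 ^ (j - c₂) : ℕ) : ℤ) • dat.kolyvaginClass Nat.prime_two M ∉
                (W.baseChange K).torsionLocalKer (v.adicCompletion K) ((2 ^ M : ℕ) : ℤ)) ∧
            ∃ dat' : KolyvaginHeegnerData Dt β ι (∏ p ∈ insert ℓ (T.erase a), p),
              (∀ X' : Finset ℕ, ∃ q : ℕ, q ∉ X' ∧ Zhang2014.IsKolyvaginPrime (W.conductorNorm ℤ) W K 2 q ∧
                I ≤ Zhang2014.kolyvaginIndex W 2 q ∧
                ∃ v : HeightOneSpectrum (𝓞 K), ((q : ℕ) : 𝓞 K) ∈ v.asIdeal ∧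
                  ((2 ^ (j - c₂) : ℕ) : ℤ) • dat'.kolyvaginClass Nat.prime_two M ∉
                    (W.baseChange K).torsionLocalKer (v.adicCompletion K) ((2 ^ M : ℕ) : ℤ)) := by
  intro W _ _ hCM hred htorQ K _ _ hK hne3 hne4 h2d _ hHN
  classical
  haveI : Fact (Nat.Prime 2) := ⟨Nat.prime_two⟩
  -- S2 off the habitat (c₁) and the uniform inflation defect (k), both from Serre's open image
  obtain ⟨c₁, hS2⟩ := chebotarevOneClassIndexAtTwo_offHabitat hSerre W hCM hred htorQ K hK hne3 hne4 h2d hHN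
  obtain ⟨k, hSah⟩ := inflationDefect_of_serre hSerre W hCM K hK.1
  refine ⟨2 * (c₁ + 2 * k + ((minimalDiscriminantInt W).natAbs + 4) + 12), c₁ + 2 * k + 4, ?_⟩
  intro Dt β ι M I T a dat j X hM hMI hT haT hj hBig
  -- the frame: `τ`, instances, Weil data, Poitou–Tate families, hybrid structures (per level)
  obtain ⟨τ, hτ1⟩ := JET.exists_algEquiv_ne_one_of_isImaginaryQuadratic K hK
  have hττ : τ * τ = 1 := mul_self_eq_one_of_isImaginaryQuadratic hK τ
  haveI : ∀ j : ℕ, NumberField (ringClassField K ι j) := JET.numberField_ringClassField K hK ι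
  haveI : (W.baseChange K).IsElliptic := by rw [baseChange]; infer_instance
  haveI hNZ : ∀ M : ℕ, NeZero (2 ^ M) := fun M ↦ ⟨pow_ne_zero M two_ne_zero⟩
  haveI : ∀ M : ℕ, Finite (geomTorsion (W.baseChange K) ((2 ^ M : ℕ) : ℤ)) := fun M ↦
    finite_geomTorsion_of_neZero (W.baseChange K) (2 ^ M)
  have hinv : ∀ M : ℕ, ∃ inv : LocalInvariants K (2 ^ M), inv.IsPerfect ∧ inv.SumLocalTermEqZero ∧
      inv.UnramifiedOrthogonal ∧ inv.SelmerComplement ∧ ∀ σ : K ≃ₐ[ℚ] K, inv.IsConjCompatible σ :=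
    fun M ↦ InputsPoitouTateSelmer.poitouTate_selmerStructure_duality_conj_holds K (2 ^ M)
  choose inv hperf hvan hUO hSC hconj using hinv
  have hweil := fun M : ℕ ↦ exists_weilDatum_liftAut_two_pow (K := K) W τ M
  choose e hμ hadd₁ hadd₂ hgal halt hnondeg hτe using hweil
  have hhyb := fun M : ℕ ↦ exists_hybridTransverseFamily (K := K) W ι M
  choose 𝒯 hTko hTku using hhyb
  -- conductor currency
  have hTp : ∀ p ∈ T, p.Prime := fun p hp ↦ (hT p hp).1.1
  have hpf : (∏ p ∈ T, p).primeFactors = T := Nat.primeFactors_prod hTp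
  obtain ⟨ℓ, hℓX, hℓT, hKol, hIℓ, -, hv, dat', hBig'⟩ :=
    primeSwapAtTwoLossy_core_hybrid_offHabitat (W := W) (τ := τ) (Dt := Dt) (β := β) (ι := ι) (e := e) (hμ := hμ)
      (hadd₁ := hadd₁) (hadd₂ := hadd₂) (hgal := hgal) (halt := halt) (hnondeg := hnondeg) (hτe := hτe)
      (inv := inv) (𝒯 := 𝒯) (hCM := hCM) (hred := hred) (htorQ := htorQ) (hK := hK) (hne3 := hne3)
      (hne4 := hne4) (h2d := h2d) (hHN := hHN) (hτ1 := hτ1) (hττ := hττ) (hSah := hSah) (hperf := hperf)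
      (hvan := hvan) (hinvc := fun M ↦ hconj M τ) (hSC := hSC) (hTko := hTko) (hTku := hTku) (h37 := h37)
      (hS2 := hS2 Dt β ι)
      X dat hM hMI (Literature.NumberTheory.Sieve.FriedlanderIwaniecPrimesSquarefree.squarefree_prod_of_primes hTp)
      (by rw [hpf]; exact hT) (by rw [hpf]; exact haT) hj hBig
  rw [hpf] at hℓT
  have hdiv : (∏ p ∈ T, p) / a * ℓ = ∏ p ∈ insert ℓ (T.erase a), p := by
    rw [show (∏ p ∈ T, p) / a = ∏ p ∈ T.erase a, p from
        Nat.div_eq_of_eq_mul_right (hTp a haT).pos (by rw [Finset.mul_prod_erase T (fun p ↦ p) haT]),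
      Finset.prod_insert (fun h ↦ hℓT (Finset.mem_of_mem_erase h)), mul_comm]
  refine ⟨ℓ, hℓX, hℓT, hKol, hIℓ, hv, hdiv ▸ dat', fun X' ↦ ?_⟩
  obtain ⟨q, hqX, hKq, hIq, v, hvq, hloc⟩ := hBig' X'
  exact ⟨q, hqX, hKq, hIq, v, hvq, by rw [kolyvaginClass_cast_swap]; exact hloc⟩

end Summit.BirchSwinnertonDyer.BirchSwinnertonDyer.Theorems.KolyvaginLowerBoundAtTwo

end
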